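import Summits.CriticalPhenomena.PercolationContinuityZ3.Theorems.PercNearOneGluingNoHeavyQuantGluedPairSDEC
import HarnessLib

/-!
# QUANT lane R8, T-DEC: FORESTS WHOSE HARD CORE IS A WIDTH-2 PAIR OF DEPTH-1 SIBLINGS ARE SDEC, ORACLE-FREE — the width-2 theorem of
# `…QuantGluedPairSDEC` plus any number of blob-hull-REDUCIBLE siblings plus any number of TAME siblings (prim-quant-census-2 gen 79)

builds on p205010 (kernel theorem, internal audit signed; external expert review pending)

Support file (`--supports stmt-CriticalPhenomena-4575`), QUANT lane census seat prim-quant-census-2 (gen 79); memo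
`run/shared/lean/prim/quant/prim-quant-census-2-g79/GLUEDPAIR-G79.md`.  Theorems only, standard axioms, no sorries, no definitions.

THE ASSEMBLY.  The node `SiblingStep` at the law level owes only forests all of whose siblings are individually hull-irreducible and not tame
(`sdec_siblings_of_reducible`, typer g40 — with the ORACLE on the rest; `sdec_cons_of_tame`, arm-1 g57).  This file records the oracle-FREE
version of both adjoining steps on the list binder and closes every forest whose irreducible, non-tame core is a PAIR of depth-1 siblings
(sub-forest laws in the blob hull: glued siblings `R^lo[q](R^K[g])`, stars, sure blocks with blobs):
* **`sdec_cons_of_reducibleSib`** — `SDEC x (ftop L) (flaw L)` for law-OK, per-sibling affordable `L`, and a law-OK affordable sibling `s` whose GATED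
  law `gate s.ρ s.q` lies in the blob hull `K_x(m)` (top `s.M`) ⟹ `SDEC x (ftop (s :: L)) (flaw (s :: L))` (`sdec_lconv_inBlobHull`; no oracle);
  **`sdec_append_reducible`** — iterated.
* **`sdec_flaw_pairCore`** — `SDEC x (ftop (Lt ++ (Lr ++ [s₁, s₂]))) (flaw (Lt ++ (Lr ++ [s₁, s₂])))` for two sibling records `s₁, s₂` with
  sub-forest laws in the blob hull at floors `yᵢ` (`x ≤ qᵢyᵢ`, `yᵢMᵢ ≤ mᵢ`), a list `Lr` of reducible siblings and a list `Lt` of tame siblings (all law-OK,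
  affordable); by `flaw_perm` the order is immaterial (`sdec_flaw_pairCore_perm`).
* **`sdec_flaw_gluedPairCore`** — the same with `s₁, s₂` glued siblings `⟨qᵢ, ·, ·, loᵢ+Kᵢ, SP[loᵢ, Kᵢ, gᵢ]⟩`, `x ≤ qᵢgᵢ`.

HONEST STATUS.  Width-2 cores only; cores of ≥ 3 irreducible non-tame siblings are the node's residue (`SiblingStep`, `FarTreeRow` OPEN); RATE class
(log\*) / honest sentence of `run/shared/lean/prim/quant/README.md` unchanged.  [this work].  Nothing here is cited as a published result.  The gluing
rows served [cite: KozmaNitzan2024, Conjecture 3 (p. 15)]; product measure [cite: Grimmett1999, §1.3 p. 10].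
-/

noncomputable section

open scoped BigOperators

namespace Summit.CriticalPhenomena.PercolationContinuityZ3.Theorems
namespace Quant
namespace LawDec

open Finset

/-- the glued sibling's sub-forest law `{lo: 1−a, lo+K: a}` in census-1's value form -/
local notation3 "SP[" lo ", " K ", " a "]" => (fun h : ℕ => (1 - (a : ℝ)) * (if h = (lo : ℕ) then (1 : ℝ) else 0) +
  (a : ℝ) * (if h = (lo : ℕ) + (K : ℕ) then (1 : ℝ) else 0))

/-! ### Adjoining a reducible sibling, oracle-free -/

/-- **ADJOINING A BLOB-HULL-REDUCIBLE SIBLING TO AN SDEC FOREST — NO ORACLE.**  `L` law-OK with per-sibling affordability and `SDEC x (ftop L) (flaw L)`;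
`s` law-OK, affordable, with `gate s.ρ s.q ∈ K_x(m)` on `{0..s.M}` ⟹ `SDEC x (ftop (s :: L)) (flaw (s :: L))`. [this work] -/
theorem sdec_cons_of_reducibleSib {x : ℝ} (hx0 : 0 < x) (hx1 : x < 1) (L : List Sib) (s : Sib)
    (hL : ∀ t ∈ L, t.LawOK) (hxL : ∀ t ∈ L, x * (t.M : ℝ) ≤ t.q * t.mean) (hS : SDEC x (ftop L) (flaw L))
    {m : ℝ} (hs : InBlobHull x m s.M (gate s.ρ s.q)) :
    SDEC x (ftop (s :: L)) (flaw (s :: L)) := by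
  obtain ⟨f0, fM, f1, fmn⟩ := flaw_facts L hL
  have hta : x * (ftop L : ℝ) ≤ ∑ h ∈ Finset.range (ftop L + 1), (h : ℝ) * flaw L h := by
    rw [fmn]; exact floor_ftop_le_fmean' x L hxL
  exact sdec_lconv_inBlobHull hx0 hx1 f0 fM f1 hta hS hs

/-- **… iterated**: an SDEC law-OK affordable forest `Lh` stays SDEC after appending any list `Lr` of law-OK affordable siblings whose gated laws are
blob-hull members at the floor. [this work] -/
theorem sdec_append_reducible {x : ℝ} (hx0 : 0 < x) (hx1 : x < 1) (Lh : List Sib) (hLh : ∀ t ∈ Lh, t.LawOK)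
    (hxLh : ∀ t ∈ Lh, x * (t.M : ℝ) ≤ t.q * t.mean) (hS : SDEC x (ftop Lh) (flaw Lh)) :
    ∀ Lr : List Sib, (∀ s ∈ Lr, s.LawOK) → (∀ s ∈ Lr, x * (s.M : ℝ) ≤ s.q * s.mean) →
      (∀ s ∈ Lr, ∃ m : ℝ, InBlobHull x m s.M (gate s.ρ s.q)) → SDEC x (ftop (Lr ++ Lh)) (flaw (Lr ++ Lh))
  | [], _, _, _ => by simpa using hS
  | s :: Lr, hLr, hxLr, hred => by
    have ih := sdec_append_reducible hx0 hx1 Lh hLh hxLh hS Lr (fun t ht => hLr t (List.mem_cons_of_mem s ht))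
      (fun t ht => hxLr t (List.mem_cons_of_mem s ht)) (fun t ht => hred t (List.mem_cons_of_mem s ht))
    have hall : ∀ t ∈ Lr ++ Lh, t.LawOK := by
      intro t ht
      rcases List.mem_append.1 ht with h | h
      · exact hLr t (List.mem_cons_of_mem s h)
      · exact hLh t h
    have hxall : ∀ t ∈ Lr ++ Lh, x * (t.M : ℝ) ≤ t.q * t.mean := by
      intro t ht
      rcases List.mem_append.1 ht with h | h
      · exact hxLr t (List.mem_cons_of_mem s h)
      · exact hxLh t h
    obtain ⟨m, hm⟩ := hred s List.mem_cons_self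
    exact sdec_cons_of_reducibleSib hx0 hx1 (Lr ++ Lh) s hall hxall ih hm

/-! ### Forests with a width-2 depth-1 core -/

/-- law-OK and affordability of a sibling record whose sub-forest law is a blob-hull member at `y` with `y·M ≤ m`, `x ≤ q·y`. [this work] -/
theorem lawOK_aff_of_subBlobHull {x : ℝ} (hx0 : 0 < x) (s : Sib) {y m : ℝ} (hy0 : 0 < y) (hq0 : 0 < s.q) (hq1 : s.q < 1)
    (hρ : InBlobHull y m s.M s.ρ) (hta : y * (s.M : ℝ) ≤ m) (hx : x ≤ s.q * y) :
    s.LawOK ∧ x * (s.M : ℝ) ≤ s.q * s.mean := by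
  obtain ⟨r0, rM, r1⟩ := hρ.lawFacts hy0.le
  have hmean : s.mean = m := by unfold Sib.mean; exact hρ.mean_eq
  refine ⟨⟨hq0, hq1, r0, rM, r1⟩, ?_⟩
  rw [hmean]
  have h1 : x * (s.M : ℝ) ≤ s.q * y * s.M := mul_le_mul_of_nonneg_right hx (Nat.cast_nonneg _)
  have h2 : s.q * (y * (s.M : ℝ)) ≤ s.q * m := mul_le_mul_of_nonneg_left hta hq0.le
  have _ := hx0
  nlinarith

/-- **EVERY FOREST WHOSE CORE IS A WIDTH-2 PAIR OF DEPTH-1 SIBLINGS IS SDEC — NO ORACLE.**  Two sibling records `s₁, s₂` with sub-forest laws in the blob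
hull (`InBlobHull yᵢ mᵢ sᵢ.M sᵢ.ρ`, `0 < yᵢ < 1`, `yᵢ·Mᵢ ≤ mᵢ`, `0 < qᵢ < 1`, `x ≤ qᵢyᵢ`), a list `Lr` of law-OK affordable siblings with gated laws in the blob
hull at `x`, and a list `Lt` of law-OK affordable TAME siblings: `SDEC x (ftop (Lt ++ (Lr ++ [s₁, s₂]))) (flaw (Lt ++ (Lr ++ [s₁, s₂])))`. [this work] -/
theorem sdec_flaw_pairCore {x : ℝ} (hx0 : 0 < x) (s₁ s₂ : Sib)
    (h₁ : 0 < s₁.q ∧ s₁.q < 1 ∧ ∃ y m : ℝ, 0 < y ∧ y < 1 ∧ InBlobHull y m s₁.M s₁.ρ ∧ y * (s₁.M : ℝ) ≤ m ∧ x ≤ s₁.q * y)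
    (h₂ : 0 < s₂.q ∧ s₂.q < 1 ∧ ∃ y m : ℝ, 0 < y ∧ y < 1 ∧ InBlobHull y m s₂.M s₂.ρ ∧ y * (s₂.M : ℝ) ≤ m ∧ x ≤ s₂.q * y)
    (Lr : List Sib) (hLr : ∀ s ∈ Lr, s.LawOK) (hxLr : ∀ s ∈ Lr, x * (s.M : ℝ) ≤ s.q * s.mean)
    (hred : ∀ s ∈ Lr, ∃ m : ℝ, InBlobHull x m s.M (gate s.ρ s.q))
    (Lt : List Sib) (hLt : ∀ s ∈ Lt, s.LawOK) (hxLt : ∀ s ∈ Lt, x * (s.M : ℝ) ≤ s.q * s.mean)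
    (htame : ∀ s ∈ Lt, ∀ h : ℕ, 1 ≤ h → s.ρ h ≠ 0 → s.q * s.mean ≤ 2 * h ∨ x * ((s.M : ℝ) - h) ≤ s.q * s.mean - h) :
    SDEC x (ftop (Lt ++ (Lr ++ [s₁, s₂]))) (flaw (Lt ++ (Lr ++ [s₁, s₂]))) := by
  have hS := sdec_flaw_two_of_subBlobHull hx0 s₁ s₂ h₁ h₂
  obtain ⟨hq₁0, hq₁1, y₁, m₁, hy₁0, hy₁1, hρ₁, hta₁, hx₁⟩ := h₁
  obtain ⟨hq₂0, hq₂1, y₂, m₂, hy₂0, _, hρ₂, hta₂, hx₂⟩ := h₂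
  have hx1 : x < 1 := by nlinarith
  have f₁ := lawOK_aff_of_subBlobHull hx0 s₁ hy₁0 hq₁0 hq₁1 hρ₁ hta₁ hx₁
  have f₂ := lawOK_aff_of_subBlobHull hx0 s₂ hy₂0 hq₂0 hq₂1 hρ₂ hta₂ hx₂
  have hLh : ∀ t ∈ [s₁, s₂], t.LawOK := by
    intro t ht; simp only [List.mem_cons, List.mem_nil_iff, or_false] at ht
    rcases ht with rfl | rfl
    exacts [f₁.1, f₂.1]
  have hxLh : ∀ t ∈ [s₁, s₂], x * (t.M : ℝ) ≤ t.q * t.mean := by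
    intro t ht; simp only [List.mem_cons, List.mem_nil_iff, or_false] at ht
    rcases ht with rfl | rfl
    exacts [f₁.2, f₂.2]
  have hR := sdec_append_reducible hx0 hx1 [s₁, s₂] hLh hxLh hS Lr hLr hxLr hred
  have hall : ∀ t ∈ Lr ++ [s₁, s₂], t.LawOK := by
    intro t ht
    rcases List.mem_append.1 ht with h | h
    exacts [hLr t h, hLh t h]
  have hxall : ∀ t ∈ Lr ++ [s₁, s₂], x * (t.M : ℝ) ≤ t.q * t.mean := by
    intro t ht
    rcases List.mem_append.1 ht with h | h
    exacts [hxLr t h, hxLh t h]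
  exact sdec_append_tame hx0 hx1 (Lr ++ [s₁, s₂]) hall hxall hR Lt hLt hxLt htame

/-- **… in any order of the siblings** (`flaw`, `ftop` are invariant under permutations). [this work] -/
theorem sdec_flaw_pairCore_perm {x : ℝ} (hx0 : 0 < x) (s₁ s₂ : Sib)
    (h₁ : 0 < s₁.q ∧ s₁.q < 1 ∧ ∃ y m : ℝ, 0 < y ∧ y < 1 ∧ InBlobHull y m s₁.M s₁.ρ ∧ y * (s₁.M : ℝ) ≤ m ∧ x ≤ s₁.q * y)
    (h₂ : 0 < s₂.q ∧ s₂.q < 1 ∧ ∃ y m : ℝ, 0 < y ∧ y < 1 ∧ InBlobHull y m s₂.M s₂.ρ ∧ y * (s₂.M : ℝ) ≤ m ∧ x ≤ s₂.q * y)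
    (Lr : List Sib) (hLr : ∀ s ∈ Lr, s.LawOK) (hxLr : ∀ s ∈ Lr, x * (s.M : ℝ) ≤ s.q * s.mean)
    (hred : ∀ s ∈ Lr, ∃ m : ℝ, InBlobHull x m s.M (gate s.ρ s.q))
    (Lt : List Sib) (hLt : ∀ s ∈ Lt, s.LawOK) (hxLt : ∀ s ∈ Lt, x * (s.M : ℝ) ≤ s.q * s.mean)
    (htame : ∀ s ∈ Lt, ∀ h : ℕ, 1 ≤ h → s.ρ h ≠ 0 → s.q * s.mean ≤ 2 * h ∨ x * ((s.M : ℝ) - h) ≤ s.q * s.mean - h)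
    (L : List Sib) (hperm : (Lt ++ (Lr ++ [s₁, s₂])).Perm L) :
    SDEC x (ftop L) (flaw L) :=
  sdec_flaw_perm hperm (sdec_flaw_pairCore hx0 s₁ s₂ h₁ h₂ Lr hLr hxLr hred Lt hLt hxLt htame)

/-- a glued sibling record has its sub-forest law in the blob hull at the blob gate: `SP[lo, K, g] ∈ K_g(lo + K·g)` (top `lo + K`), affordable
(`g ≤ 1`). [this work] -/
theorem subBlobHull_of_gluedSib (s : Sib) {lo K : ℕ} {g : ℝ} (hM : s.M = lo + K) (hg1 : g ≤ 1) (hρ : s.ρ = SP[lo, K, g]) :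
    InBlobHull g ((lo : ℝ) + K * g) s.M s.ρ ∧ g * (s.M : ℝ) ≤ (lo : ℝ) + K * g := by
  have hl : ∀ p ∈ [((K : ℕ), g), (lo, (1 : ℝ))], g ≤ p.2 ∧ p.2 ≤ 1 := by
    intro p hp
    simp only [List.mem_cons, List.mem_nil_iff, or_false] at hp
    rcases hp with rfl | rfl
    · exact ⟨le_rfl, hg1⟩
    · exact ⟨hg1, le_rfl⟩
  have h := inBlobHull_blobLaw g [((K : ℕ), g), (lo, (1 : ℝ))] hl (M := s.M) (by rw [blobTop_glued, hM])
  have em : blobMean [((K : ℕ), g), (lo, (1 : ℝ))] = (lo : ℝ) + K * g := by simp [blobMean]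
  rw [em, blobLaw_glued_eq_sp, ← hρ] at h
  refine ⟨h, ?_⟩
  rw [hM]; push_cast; nlinarith [Nat.cast_nonneg (α := ℝ) lo]

/-- **EVERY FOREST WHOSE CORE IS A PAIR OF GLUED SIBLINGS IS SDEC — NO ORACLE**: `s₁, s₂` glued (`⟨qᵢ, ·, ·, loᵢ+Kᵢ, SP[loᵢ, Kᵢ, gᵢ]⟩`, `0 < qᵢ, gᵢ < 1`,
`x ≤ qᵢgᵢ`), `Lr` reducible, `Lt` tame (law-OK, affordable): `SDEC x (ftop (Lt ++ (Lr ++ [s₁, s₂]))) (flaw (Lt ++ (Lr ++ [s₁, s₂])))`. [this work] -/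
theorem sdec_flaw_gluedPairCore {x : ℝ} (hx0 : 0 < x) (s₁ s₂ : Sib)
    (h₁ : 0 < s₁.q ∧ s₁.q < 1 ∧ ∃ (lo K : ℕ) (g : ℝ), s₁.M = lo + K ∧ 0 < g ∧ g < 1 ∧ s₁.ρ = SP[lo, K, g] ∧ x ≤ s₁.q * g)
    (h₂ : 0 < s₂.q ∧ s₂.q < 1 ∧ ∃ (lo K : ℕ) (g : ℝ), s₂.M = lo + K ∧ 0 < g ∧ g < 1 ∧ s₂.ρ = SP[lo, K, g] ∧ x ≤ s₂.q * g)
    (Lr : List Sib) (hLr : ∀ s ∈ Lr, s.LawOK) (hxLr : ∀ s ∈ Lr, x * (s.M : ℝ) ≤ s.q * s.mean)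
    (hred : ∀ s ∈ Lr, ∃ m : ℝ, InBlobHull x m s.M (gate s.ρ s.q))
    (Lt : List Sib) (hLt : ∀ s ∈ Lt, s.LawOK) (hxLt : ∀ s ∈ Lt, x * (s.M : ℝ) ≤ s.q * s.mean)
    (htame : ∀ s ∈ Lt, ∀ h : ℕ, 1 ≤ h → s.ρ h ≠ 0 → s.q * s.mean ≤ 2 * h ∨ x * ((s.M : ℝ) - h) ≤ s.q * s.mean - h) :
    SDEC x (ftop (Lt ++ (Lr ++ [s₁, s₂]))) (flaw (Lt ++ (Lr ++ [s₁, s₂]))) := by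
  obtain ⟨hq₁0, hq₁1, lo₁, K₁, g₁, hM₁, hg₁0, hg₁1, hρ₁, hx₁⟩ := h₁
  obtain ⟨hq₂0, hq₂1, lo₂, K₂, g₂, hM₂, hg₂0, hg₂1, hρ₂, hx₂⟩ := h₂
  obtain ⟨b₁, a₁⟩ := subBlobHull_of_gluedSib s₁ hM₁ hg₁1.le hρ₁
  obtain ⟨b₂, a₂⟩ := subBlobHull_of_gluedSib s₂ hM₂ hg₂1.le hρ₂
  exact sdec_flaw_pairCore hx0 s₁ s₂ ⟨hq₁0, hq₁1, g₁, _, hg₁0, hg₁1, b₁, a₁, hx₁⟩ ⟨hq₂0, hq₂1, g₂, _, hg₂0, hg₂1, b₂, a₂, hx₂⟩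
    Lr hLr hxLr hred Lt hLt hxLt htame


/-! ### Appendix: the hull-OUT corner laws of census-2 g77/g78 are SDEC at their natural floors (explicit instances of `sdec_lpT_all`) -/

/-- **THE R8-CERTIFICATE CORNER**: `lpT 4 (17/25) (499/680) = (.32δ₀ + .181δ₁ + .499δ₅)^{∗2}` — NOT in the gated caterpillar hull at floor `997/2000`
(`lpT_corner997_out`, ✓ `…QuantCatHullCertR8Main`, hence `¬TreeBuiltCatHullLight`, `¬CatPairLight`) — IS SDEC at its natural floor `qs = 499/1000` (and so at
`997/2000`): the node of record holds where route 2's hull fails. [this work] -/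
theorem sdec_lpT_corner997 : SDEC (499 / 1000 : ℝ) 10 (lpT 4 (17 / 25) (499 / 680)) := by
  have h := sdec_lpT_all 4 (17 / 25 : ℝ) (499 / 680) (by norm_num) (by norm_num) (by norm_num) (by norm_num)
  norm_num at h
  exact h

/-- … and at the certificate's floor `997/2000`. [this work] -/
theorem sdec_lpT_corner997_floor : SDEC (997 / 2000 : ℝ) 10 (lpT 4 (17 / 25) (499 / 680)) :=
  sdec_mono sdec_lpT_corner997 (by norm_num) (by norm_num)

/-- **THE g77 CORNER**: `lpT 4 (3/5) (49/60)` (hull-OUT at floors `.4875`–`.49` by census-2 g77's exact B&B, kit j272666) is SDEC at its natural floor `49/100`.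
[this work] -/
theorem sdec_lpT_corner49 : SDEC (49 / 100 : ℝ) 10 (lpT 4 (3 / 5) (49 / 60)) := by
  have h := sdec_lpT_all 4 (3 / 5 : ℝ) (49 / 60) (by norm_num) (by norm_num) (by norm_num) (by norm_num)
  norm_num at h
  exact h

end LawDec
end Quant
end Summit.CriticalPhenomena.PercolationContinuityZ3.Theorems
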